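import Mathlib.Topology.ContinuousMap.Bounded.Normed
import Summits.AtomisticToContinuum.HydrodynamicLimit.Theorems.TwoClocksEquilibriumFastWindowLDReductionBounded
import Summits.AtomisticToContinuum.HydrodynamicLimit.Theorems.EnskogAdjointDualityDualityReductionMaxwellian

/-!
# The Banach space of weighted fast one-body observables
(crux stmt-AtomisticToContinuum-14440 `TwoClocks.EquilibriumFastWindowLD`, line `Sketch`; lead c4)

Helper file (`--supports stmt-AtomisticToContinuum-14440`). The admissible observables of the crux
are the continuous `F : 𝕋³ × ℝ³ → ℝ` of quadratic velocity growth, `|F(x,v)| ≤ C (1 + |v|²)`,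
orthogonal at every `x`, under the Maxwellian `M = M_{1,u₀,θ₀}`, to `1, v_j, |v|²`. Dividing by the
weight `ω(x,v) = 1 + |v|²` identifies them with a CLOSED LINEAR SUBSPACE of the Banach space
`𝕋³ × ℝ³ →ᵇ ℝ` of bounded continuous functions (sup norm = the weighted growth constant), on which
the Baire category theorem will be run (`TwoClocksEquilibriumFastWindowLDNormalFormEquivalence`):

* `continuous_integral_apply_mul` — for an integrable weight `W`, `f ↦ ∫ f(x,v) W(v) dv` is
  (Lipschitz) continuous on `𝕋³ × ℝ³ →ᵇ ℝ`;
* `integrable_quadWeight_mul_mul_localMaxwellian` — the weights `ω M`, `ω v_j M`, `ω |v|² M` are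
  Lebesgue integrable (Gaussian moments, `integrable_localMaxwellian_mul_of_abs_le`);
* `isClosed_fastClass` — the encoded admissible class
  `{f | ∀ x, ∫ f ω M = 0 ∧ ∀ x j, ∫ f ω v_j M = 0 ∧ ∀ x, ∫ f ω |v|² M = 0}` is closed, contains `0`
  and is stable under `+`, `−`, real scalings (`zero_mem_fastClass`, `add_mem_fastClass`,
  `neg_mem_fastClass`, `smul_mem_fastClass`; the coordinate bound `|v_j| ≤ 1 + |v|²` is
  `KineticCurrentsWindowLDUniformLocalGibbs.shd_abs_apply_le`, inlined here);
* `exists_boundedContinuous_mul_quadWeight_eq` — decoding: every continuous `G` with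
  `|G(x,v)| ≤ C(1+|v|²)` is `f ω` with `‖f‖ ≤ C`.

No new definitions (the class is written out; `ω` is `1 + ‖v‖²` verbatim).
-/

noncomputable section

open MeasureTheory ProbabilityTheory Real Set Filter
open scoped ENNReal BigOperators BoundedContinuousFunction

namespace Summit.AtomisticToContinuum.HydrodynamicLimit.Theorems.FastWindowRG

open Literature.Analysis.FluidPDE Literature.MathematicalPhysics.KineticTheory

/-! ### The encoding `F = f · (1 + |v|²)` -/

/-- `F_f = f ω` is continuous. -/
theorem continuous_mul_quadWeight (f : T3 × V3 →ᵇ ℝ) :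
    Continuous fun y : T3 × V3 => f y * (1 + ‖y.2‖ ^ 2) := by
  have := f.continuous
  fun_prop

/-- `F_f = f ω` has weighted growth constant `‖f‖`. -/
theorem abs_mul_quadWeight_le (f : T3 × V3 →ᵇ ℝ) (y : T3 × V3) :
    |f y * (1 + ‖y.2‖ ^ 2)| ≤ ‖f‖ * (1 + ‖y.2‖ ^ 2) := by
  have hpos : (0 : ℝ) < 1 + ‖y.2‖ ^ 2 := by positivity
  rw [abs_mul, abs_of_pos hpos]
  have h : |f y| ≤ ‖f‖ := by rw [← Real.norm_eq_abs]; exact f.norm_coe_le_norm y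
  exact mul_le_mul_of_nonneg_right h hpos.le

/-- Decoding: a continuous `G` with `|G(x,v)| ≤ C (1 + |v|²)` is `f ω` for a bounded continuous
`f = G / ω` with `‖f‖ ≤ C`. -/
theorem exists_boundedContinuous_mul_quadWeight_eq {G : T3 × V3 → ℝ} (hG : Continuous G) {C : ℝ}
    (hC : 0 ≤ C) (hGC : ∀ y, |G y| ≤ C * (1 + ‖y.2‖ ^ 2)) :
    ∃ f : T3 × V3 →ᵇ ℝ, ‖f‖ ≤ C ∧ ∀ y, f y * (1 + ‖y.2‖ ^ 2) = G y := by
  have hpos : ∀ y : T3 × V3, (0 : ℝ) < 1 + ‖y.2‖ ^ 2 := fun y => by positivity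
  have hc : Continuous fun y : T3 × V3 => G y / (1 + ‖y.2‖ ^ 2) :=
    hG.div (by fun_prop) fun y => (hpos y).ne'
  have hb : ∀ y : T3 × V3, ‖G y / (1 + ‖y.2‖ ^ 2)‖ ≤ C := fun y => by
    rw [Real.norm_eq_abs, abs_div, abs_of_pos (hpos y), div_le_iff₀ (hpos y)]
    exact hGC y
  refine ⟨BoundedContinuousFunction.ofNormedAddCommGroup _ hc C hb,
    BoundedContinuousFunction.norm_ofNormedAddCommGroup_le hc hC hb, fun y => ?_⟩
  simp only [BoundedContinuousFunction.coe_ofNormedAddCommGroup]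
  exact div_mul_cancel₀ _ (hpos y).ne'

/-! ### Continuity of the Maxwellian pairings on `𝕋³ × ℝ³ →ᵇ ℝ` -/

/-- For an integrable weight `W` and a position `x`, `f ↦ ∫ f(x, v) W(v) dv` is continuous on the
Banach space of bounded continuous functions (it is `∫|W|`-Lipschitz). -/
theorem continuous_integral_apply_mul :
    ∀ {W : V3 → ℝ}, Integrable W → ∀ x : T3,
      Continuous fun f : BoundedContinuousFunction (T3 × V3) ℝ => ∫ v, f (x, v) * W v := by
  intro W hW x
  have hint : ∀ f : T3 × V3 →ᵇ ℝ, Integrable (fun v => f (x, v) * W v) := fun f =>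
    hW.bdd_mul (f.continuous.comp (Continuous.prodMk_right x)).aestronglyMeasurable
      (ae_of_all _ fun v => f.norm_coe_le_norm (x, v))
  refine (LipschitzWith.of_dist_le_mul (K := (∫ v, ‖W v‖).toNNReal) fun f g => ?_).continuous
  rw [Real.dist_eq, ← integral_sub (hint f) (hint g), Real.coe_toNNReal _
    (integral_nonneg fun v => norm_nonneg _), dist_eq_norm]
  have hptw : ∀ v, ‖(f (x, v) * W v - g (x, v) * W v)‖ ≤ ‖f - g‖ * ‖W v‖ := fun v => by
    rw [← sub_mul, norm_mul]
    exact mul_le_mul_of_nonneg_right ((f - g).norm_coe_le_norm (x, v)) (norm_nonneg _)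
  calc |∫ v, f (x, v) * W v - g (x, v) * W v|
      = ‖∫ v, f (x, v) * W v - g (x, v) * W v‖ := (Real.norm_eq_abs _).symm
    _ ≤ ∫ v, ‖f - g‖ * ‖W v‖ := norm_integral_le_of_norm_le (hW.norm.const_mul _) (ae_of_all _ hptw)
    _ = (∫ v, ‖W v‖) * ‖f - g‖ := by rw [integral_const_mul, mul_comm]

/-- The Maxwellian weights of the crux are Lebesgue integrable after multiplication by the
quadratic weight: for continuous `φ` with `|φ(v)| ≤ 1 + |v|²` (e.g. `φ = 1, v_j, |v|²`),
`v ↦ (1 + |v|²) φ(v) M_{1,u₀,θ₀}(v)` is integrable. -/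
theorem integrable_quadWeight_mul_mul_localMaxwellian {θ₀ : ℝ} (hθ : 0 < θ₀) (u₀ : V3)
    {φ : V3 → ℝ} (hφm : Continuous φ) (hφ : ∀ v, |φ v| ≤ 1 + ‖v‖ ^ 2) :
    Integrable (fun v : V3 => (1 + ‖v‖ ^ 2) * φ v * localMaxwellian 1 θ₀ u₀ v) := by
  have hg : AEStronglyMeasurable (fun v : V3 => (1 + ‖v‖ ^ 2) * φ v) volume := by
    refine Continuous.aestronglyMeasurable ?_
    fun_prop
  have hK : ∀ v : V3, |(1 + ‖v‖ ^ 2) * φ v| ≤ 1 * (1 + ‖v‖ ^ 2) ^ 2 := fun v => by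
    have hpos : (0 : ℝ) < 1 + ‖v‖ ^ 2 := by positivity
    have h1 : (1 + ‖v‖ ^ 2) * |φ v| ≤ (1 + ‖v‖ ^ 2) * (1 + ‖v‖ ^ 2) :=
      mul_le_mul_of_nonneg_left (hφ v) hpos.le
    calc |(1 + ‖v‖ ^ 2) * φ v| = (1 + ‖v‖ ^ 2) * |φ v| := by rw [abs_mul, abs_of_pos hpos]
      _ ≤ (1 + ‖v‖ ^ 2) * (1 + ‖v‖ ^ 2) := h1
      _ = 1 * (1 + ‖v‖ ^ 2) ^ 2 := by ring
  have h := integrable_localMaxwellian_mul_of_abs_le hθ u₀ hg hK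
  refine h.congr (ae_of_all _ fun v => ?_)
  simp only
  ring

/-- Integrability of the three pairings of `f ω` for a bounded continuous `f`. -/
theorem integrable_mul_quadWeight_pairings {θ₀ : ℝ} (hθ : 0 < θ₀) (u₀ : V3) (f : T3 × V3 →ᵇ ℝ)
    (x : T3) :
    Integrable (fun v : V3 => f (x, v) * (1 + ‖v‖ ^ 2) * localMaxwellian 1 θ₀ u₀ v) ∧
    (∀ j : Fin 3,
      Integrable (fun v : V3 => f (x, v) * (1 + ‖v‖ ^ 2) * v j * localMaxwellian 1 θ₀ u₀ v)) ∧
    Integrable (fun v : V3 => f (x, v) * (1 + ‖v‖ ^ 2) * ‖v‖ ^ 2 * localMaxwellian 1 θ₀ u₀ v) := by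
  have hfm : AEStronglyMeasurable (fun v : V3 => f (x, v)) volume :=
    (f.continuous.comp (Continuous.prodMk_right x)).aestronglyMeasurable
  have hfb : ∀ᵐ v : V3, ‖f (x, v)‖ ≤ ‖f‖ := ae_of_all _ fun v => f.norm_coe_le_norm (x, v)
  refine ⟨?_, fun j => ?_, ?_⟩
  · have hW := integrable_quadWeight_mul_mul_localMaxwellian hθ u₀ (φ := fun _ => (1 : ℝ))
      continuous_const (fun v => by rw [abs_one]; nlinarith [norm_nonneg v])
    refine (hW.bdd_mul hfm hfb).congr (ae_of_all _ fun v => ?_)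
    simp only; ring
  · have hW := integrable_quadWeight_mul_mul_localMaxwellian hθ u₀ (φ := fun v : V3 => v j)
      (by fun_prop) (fun v => by
        have h1 : |v j| ≤ ‖v‖ := by rw [← Real.norm_eq_abs]; exact PiLp.norm_apply_le v j
        nlinarith [norm_nonneg v, sq_nonneg (‖v‖ - 1)])
    refine (hW.bdd_mul hfm hfb).congr (ae_of_all _ fun v => ?_)
    simp only; ring
  · have hW := integrable_quadWeight_mul_mul_localMaxwellian hθ u₀ (φ := fun v : V3 => ‖v‖ ^ 2)
      (by fun_prop) (fun v => by rw [abs_of_nonneg (by positivity)]; nlinarith [norm_nonneg v])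
    refine (hW.bdd_mul hfm hfb).congr (ae_of_all _ fun v => ?_)
    simp only; ring

/-! ### The encoded admissible class -/

/-- **The encoded admissible class is closed** in `𝕋³ × ℝ³ →ᵇ ℝ` (each orthogonality relation is
the zero set of a continuous functional, `continuous_integral_apply_mul`). -/
theorem isClosed_fastClass {θ₀ : ℝ} (hθ : 0 < θ₀) (u₀ : V3) :
    IsClosed {f : T3 × V3 →ᵇ ℝ |
      (∀ x, ∫ v, f (x, v) * (1 + ‖v‖ ^ 2) * localMaxwellian 1 θ₀ u₀ v = 0) ∧
      (∀ x (j : Fin 3), ∫ v, f (x, v) * (1 + ‖v‖ ^ 2) * v j * localMaxwellian 1 θ₀ u₀ v = 0) ∧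
      (∀ x, ∫ v, f (x, v) * (1 + ‖v‖ ^ 2) * ‖v‖ ^ 2 * localMaxwellian 1 θ₀ u₀ v = 0)} := by
  -- the three families of continuous functionals
  have h0 : ∀ x, Continuous fun f : T3 × V3 →ᵇ ℝ =>
      ∫ v, f (x, v) * (1 + ‖v‖ ^ 2) * localMaxwellian 1 θ₀ u₀ v := by
    intro x
    have hW := integrable_quadWeight_mul_mul_localMaxwellian hθ u₀ (φ := fun _ => (1 : ℝ))
      continuous_const (fun v => by rw [abs_one]; nlinarith [norm_nonneg v])
    refine (continuous_integral_apply_mul hW x).congr fun f => ?_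
    refine integral_congr_ae (ae_of_all _ fun v => ?_)
    simp only
    ring
  have h1 : ∀ x (j : Fin 3), Continuous fun f : T3 × V3 →ᵇ ℝ =>
      ∫ v, f (x, v) * (1 + ‖v‖ ^ 2) * v j * localMaxwellian 1 θ₀ u₀ v := by
    intro x j
    have hW := integrable_quadWeight_mul_mul_localMaxwellian hθ u₀ (φ := fun v : V3 => v j)
      (by fun_prop) (fun v => by
        have h1 : |v j| ≤ ‖v‖ := by rw [← Real.norm_eq_abs]; exact PiLp.norm_apply_le v j
        nlinarith [norm_nonneg v, sq_nonneg (‖v‖ - 1)])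
    refine (continuous_integral_apply_mul hW x).congr fun f => ?_
    refine integral_congr_ae (ae_of_all _ fun v => ?_)
    simp only
    ring
  have h2 : ∀ x, Continuous fun f : T3 × V3 →ᵇ ℝ =>
      ∫ v, f (x, v) * (1 + ‖v‖ ^ 2) * ‖v‖ ^ 2 * localMaxwellian 1 θ₀ u₀ v := by
    intro x
    have hW := integrable_quadWeight_mul_mul_localMaxwellian hθ u₀ (φ := fun v : V3 => ‖v‖ ^ 2)
      (by fun_prop) (fun v => by rw [abs_of_nonneg (by positivity)]; nlinarith [norm_nonneg v])
    refine (continuous_integral_apply_mul hW x).congr fun f => ?_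
    refine integral_congr_ae (ae_of_all _ fun v => ?_)
    simp only
    ring
  have e : {f : T3 × V3 →ᵇ ℝ |
      (∀ x, ∫ v, f (x, v) * (1 + ‖v‖ ^ 2) * localMaxwellian 1 θ₀ u₀ v = 0) ∧
      (∀ x (j : Fin 3), ∫ v, f (x, v) * (1 + ‖v‖ ^ 2) * v j * localMaxwellian 1 θ₀ u₀ v = 0) ∧
      (∀ x, ∫ v, f (x, v) * (1 + ‖v‖ ^ 2) * ‖v‖ ^ 2 * localMaxwellian 1 θ₀ u₀ v = 0)} =
      (⋂ x, {f : T3 × V3 →ᵇ ℝ | ∫ v, f (x, v) * (1 + ‖v‖ ^ 2) * localMaxwellian 1 θ₀ u₀ v = 0}) ∩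
      ((⋂ x, ⋂ j : Fin 3, {f : T3 × V3 →ᵇ ℝ |
          ∫ v, f (x, v) * (1 + ‖v‖ ^ 2) * v j * localMaxwellian 1 θ₀ u₀ v = 0}) ∩
        ⋂ x, {f : T3 × V3 →ᵇ ℝ |
          ∫ v, f (x, v) * (1 + ‖v‖ ^ 2) * ‖v‖ ^ 2 * localMaxwellian 1 θ₀ u₀ v = 0}) := by
    ext f
    simp only [mem_setOf_eq, mem_inter_iff, mem_iInter]
  rw [e]
  exact (isClosed_iInter fun x => isClosed_eq (h0 x) continuous_const).inter
    ((isClosed_iInter fun x => isClosed_iInter fun j => isClosed_eq (h1 x j) continuous_const).inter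
      (isClosed_iInter fun x => isClosed_eq (h2 x) continuous_const))

/-- `0` is in the class. -/
theorem zero_mem_fastClass (θ₀ : ℝ) (u₀ : V3) :
    (0 : T3 × V3 →ᵇ ℝ) ∈ {f : T3 × V3 →ᵇ ℝ |
      (∀ x, ∫ v, f (x, v) * (1 + ‖v‖ ^ 2) * localMaxwellian 1 θ₀ u₀ v = 0) ∧
      (∀ x (j : Fin 3), ∫ v, f (x, v) * (1 + ‖v‖ ^ 2) * v j * localMaxwellian 1 θ₀ u₀ v = 0) ∧
      (∀ x, ∫ v, f (x, v) * (1 + ‖v‖ ^ 2) * ‖v‖ ^ 2 * localMaxwellian 1 θ₀ u₀ v = 0)} := by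
  simp

/-- The class is stable under addition. -/
theorem add_mem_fastClass {θ₀ : ℝ} (hθ : 0 < θ₀) (u₀ : V3) :
    ∀ f ∈ {f : T3 × V3 →ᵇ ℝ |
      (∀ x, ∫ v, f (x, v) * (1 + ‖v‖ ^ 2) * localMaxwellian 1 θ₀ u₀ v = 0) ∧
      (∀ x (j : Fin 3), ∫ v, f (x, v) * (1 + ‖v‖ ^ 2) * v j * localMaxwellian 1 θ₀ u₀ v = 0) ∧
      (∀ x, ∫ v, f (x, v) * (1 + ‖v‖ ^ 2) * ‖v‖ ^ 2 * localMaxwellian 1 θ₀ u₀ v = 0)},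
    ∀ g ∈ {f : T3 × V3 →ᵇ ℝ |
      (∀ x, ∫ v, f (x, v) * (1 + ‖v‖ ^ 2) * localMaxwellian 1 θ₀ u₀ v = 0) ∧
      (∀ x (j : Fin 3), ∫ v, f (x, v) * (1 + ‖v‖ ^ 2) * v j * localMaxwellian 1 θ₀ u₀ v = 0) ∧
      (∀ x, ∫ v, f (x, v) * (1 + ‖v‖ ^ 2) * ‖v‖ ^ 2 * localMaxwellian 1 θ₀ u₀ v = 0)},
    f + g ∈ {f : T3 × V3 →ᵇ ℝ |
      (∀ x, ∫ v, f (x, v) * (1 + ‖v‖ ^ 2) * localMaxwellian 1 θ₀ u₀ v = 0) ∧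
      (∀ x (j : Fin 3), ∫ v, f (x, v) * (1 + ‖v‖ ^ 2) * v j * localMaxwellian 1 θ₀ u₀ v = 0) ∧
      (∀ x, ∫ v, f (x, v) * (1 + ‖v‖ ^ 2) * ‖v‖ ^ 2 * localMaxwellian 1 θ₀ u₀ v = 0)} := by
  rintro f ⟨hf0, hf1, hf2⟩ g ⟨hg0, hg1, hg2⟩
  refine ⟨fun x => ?_, fun x j => ?_, fun x => ?_⟩
  · obtain ⟨hF, -, -⟩ := integrable_mul_quadWeight_pairings hθ u₀ f x
    obtain ⟨hG, -, -⟩ := integrable_mul_quadWeight_pairings hθ u₀ g x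
    simp_rw [BoundedContinuousFunction.add_apply, add_mul]
    rw [integral_add hF hG, hf0 x, hg0 x, add_zero]
  · obtain ⟨-, hF, -⟩ := integrable_mul_quadWeight_pairings hθ u₀ f x
    obtain ⟨-, hG, -⟩ := integrable_mul_quadWeight_pairings hθ u₀ g x
    simp_rw [BoundedContinuousFunction.add_apply, add_mul]
    rw [integral_add (hF j) (hG j), hf1 x j, hg1 x j, add_zero]
  · obtain ⟨-, -, hF⟩ := integrable_mul_quadWeight_pairings hθ u₀ f x
    obtain ⟨-, -, hG⟩ := integrable_mul_quadWeight_pairings hθ u₀ g x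
    simp_rw [BoundedContinuousFunction.add_apply, add_mul]
    rw [integral_add hF hG, hf2 x, hg2 x, add_zero]

/-- The class is stable under real scalings. -/
theorem smul_mem_fastClass (θ₀ : ℝ) (u₀ : V3) (c : ℝ) :
    ∀ f ∈ {f : T3 × V3 →ᵇ ℝ |
      (∀ x, ∫ v, f (x, v) * (1 + ‖v‖ ^ 2) * localMaxwellian 1 θ₀ u₀ v = 0) ∧
      (∀ x (j : Fin 3), ∫ v, f (x, v) * (1 + ‖v‖ ^ 2) * v j * localMaxwellian 1 θ₀ u₀ v = 0) ∧
      (∀ x, ∫ v, f (x, v) * (1 + ‖v‖ ^ 2) * ‖v‖ ^ 2 * localMaxwellian 1 θ₀ u₀ v = 0)},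
    c • f ∈ {f : T3 × V3 →ᵇ ℝ |
      (∀ x, ∫ v, f (x, v) * (1 + ‖v‖ ^ 2) * localMaxwellian 1 θ₀ u₀ v = 0) ∧
      (∀ x (j : Fin 3), ∫ v, f (x, v) * (1 + ‖v‖ ^ 2) * v j * localMaxwellian 1 θ₀ u₀ v = 0) ∧
      (∀ x, ∫ v, f (x, v) * (1 + ‖v‖ ^ 2) * ‖v‖ ^ 2 * localMaxwellian 1 θ₀ u₀ v = 0)} := by
  rintro f ⟨hf0, hf1, hf2⟩
  refine ⟨fun x => ?_, fun x j => ?_, fun x => ?_⟩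
  · simp_rw [BoundedContinuousFunction.smul_apply, smul_eq_mul, mul_assoc]
    rw [integral_const_mul]
    simp_rw [← mul_assoc]
    rw [hf0 x, mul_zero]
  · simp_rw [BoundedContinuousFunction.smul_apply, smul_eq_mul, mul_assoc]
    rw [integral_const_mul]
    simp_rw [← mul_assoc]
    rw [hf1 x j, mul_zero]
  · simp_rw [BoundedContinuousFunction.smul_apply, smul_eq_mul, mul_assoc]
    rw [integral_const_mul]
    simp_rw [← mul_assoc]
    rw [hf2 x, mul_zero]

/-- The class is stable under negation. -/
theorem neg_mem_fastClass (θ₀ : ℝ) (u₀ : V3) :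
    ∀ f ∈ {f : T3 × V3 →ᵇ ℝ |
      (∀ x, ∫ v, f (x, v) * (1 + ‖v‖ ^ 2) * localMaxwellian 1 θ₀ u₀ v = 0) ∧
      (∀ x (j : Fin 3), ∫ v, f (x, v) * (1 + ‖v‖ ^ 2) * v j * localMaxwellian 1 θ₀ u₀ v = 0) ∧
      (∀ x, ∫ v, f (x, v) * (1 + ‖v‖ ^ 2) * ‖v‖ ^ 2 * localMaxwellian 1 θ₀ u₀ v = 0)},
    -f ∈ {f : T3 × V3 →ᵇ ℝ |
      (∀ x, ∫ v, f (x, v) * (1 + ‖v‖ ^ 2) * localMaxwellian 1 θ₀ u₀ v = 0) ∧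
      (∀ x (j : Fin 3), ∫ v, f (x, v) * (1 + ‖v‖ ^ 2) * v j * localMaxwellian 1 θ₀ u₀ v = 0) ∧
      (∀ x, ∫ v, f (x, v) * (1 + ‖v‖ ^ 2) * ‖v‖ ^ 2 * localMaxwellian 1 θ₀ u₀ v = 0)} := by
  intro f hf
  have h := smul_mem_fastClass θ₀ u₀ (-1) f hf
  have e : (-1 : ℝ) • f = -f := by ext y; simp
  rwa [e] at h

end Summit.AtomisticToContinuum.HydrodynamicLimit.Theorems.FastWindowRG

end
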